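import Summits.Schanuel.Schanuel.Theorems.ZilberEacFixedFibreExistence
import Summits.Schanuel.Schanuel.Theorems.ZilberEacPowerGrowthElimination
import Summits.Schanuel.Schanuel.Theorems.ZilberEacRealHyperplaneDensity
import HarnessLib

/-!
# Zero fibre polynomials: Zariski density by the FIXED-POINT-FIBRE regime

Zilber's Exponential-Algebraic Closedness, case ladder (host summit Schanuel, cell `pub-schanuel`,
seat 2, gen 15; HANDOFF O60′ (ii′)).  For the explicit free families
`W = {x₂ = r₀x₀ + r₁x₁ + c, y₀ = x₀ + y₂F₀(y₂), y₁ = x₁} ⊆ ℂ³ × ℂ³` (`F₁ = 0`) and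
`W = {x₂ = r₀x₀ + r₁x₁ + c, y₀ = x₀, y₁ = x₁}` (`F₀ = F₁ = 0`), `r₀ ∉ ℚ ∨ r₁ ∉ ℚ`, the exponential
points are Zariski dense: the coordinate `x₁` runs over the fixed points `ξ_k` of `exp`
(`exists_solutions_fixedFibre` / `exists_expFixedPoints`) with a FREE label `k ≍ m^β`, so the points
have the three power growth rates `(1, β, r₀ + βr₁)` in `(y₀, x₁, y₂) = (inr 0, inl 1, inr 2)`;
the weights `(d₀ + r₀d₂) + β(d₁ + r₁d₂)` are injective on any finite set for SOME admissible `β`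
(`exists_mem_injOn_affine`; `(d₀ + r₀d₂, d₁ + r₁d₂)` determines `d` when one `rⱼ ∉ ℚ`), and
THEOREM I⁽ᵏ⁾ (`unprojectedDense_of_powerGrowth_family`) applies.

* `fixedFibreWeights_injective`, `isOpen_fixedFibreAdmissible`, `fixedFibre_powerGrowth` (the
  common growth bookkeeping), **`unprojectedDense_polyFibredGraph_fixedFibre`** (`F₁ = 0`,
  `∃ β > 0: 0 < r₀ + βr₁ < 1/(deg F₀ + 1)`), **`unprojectedDense_polyFibredGraph_zeroFibres`**
  (`F₀ = F₁ = 0`, no further condition).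

HONEST FRAMING: explicit families inside the OPEN cell `ECCell 3 2`; NOT Schanuel's conjecture;
EAC ⇏ SC.
-/

noncomputable section

open Complex MvPolynomial Filter Topology
open Literature.NumberTheory.Transcendental Literature.ModelTheory.Zilber

set_option linter.dupNamespace false

namespace Summit.Schanuel.Schanuel.Theorems

section FixedFibreDensity

/-- **The weights of the fixed-point-fibre regime are jointly injective**: `(d₀ + r₀d₂, d₁ + r₁d₂)`
determines `d ∈ ℕ³` when `r₀ ∉ ℚ` or `r₁ ∉ ℚ`. [folklore] -/
theorem fixedFibreWeights_injective {r₀ r₁ : ℝ} (hirr : Irrational r₀ ∨ Irrational r₁)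
    (d d' : Fin 3 →₀ ℕ) (h1 : (d 0 : ℝ) + r₀ * (d 2 : ℝ) = (d' 0 : ℝ) + r₀ * (d' 2 : ℝ))
    (h2 : (d 1 : ℝ) + r₁ * (d 2 : ℝ) = (d' 1 : ℝ) + r₁ * (d' 2 : ℝ)) : d = d' := by
  by_cases hb0 : ((d' 2 : ℝ) - d 2) = 0
  · have h2' : d 2 = d' 2 := by
      have : (d' 2 : ℝ) = d 2 := by linarith
      exact_mod_cast this.symm
    have h0' : d 0 = d' 0 := by
      have : (d 0 : ℝ) = d' 0 := by rw [h2'] at h1; linarith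
      exact_mod_cast this
    have h1' : d 1 = d' 1 := by
      have : (d 1 : ℝ) = d' 1 := by rw [h2'] at h2; linarith
      exact_mod_cast this
    ext i
    fin_cases i
    · exact h0'
    · exact h1'
    · exact h2'
  · exfalso
    have hbZ : ((d' 2 : ℤ) - d 2 : ℤ) ≠ 0 := by exact_mod_cast hb0
    have hr₀q : r₀ = ((d 0 : ℤ) - d' 0 : ℤ) / ((d' 2 : ℤ) - d 2 : ℤ) := by
      push_cast; field_simp; linarith
    have hr₁q : r₁ = ((d 1 : ℤ) - d' 1 : ℤ) / ((d' 2 : ℤ) - d 2 : ℤ) := by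
      push_cast; field_simp; linarith
    rcases hirr with h | h
    · exact (irrational_iff_ne_rational r₀).1 h _ _ hbZ hr₀q
    · exact (irrational_iff_ne_rational r₁).1 h _ _ hbZ hr₁q

/-- The admissible exponents `{β > 0 : 0 < r₀ + βr₁, (r₀ + βr₁)e₀ < 1}` form an open set.
[folklore] -/
theorem isOpen_fixedFibreAdmissible (r₀ r₁ e₀ : ℝ) :
    IsOpen {β : ℝ | 0 < β ∧ 0 < r₀ + β * r₁ ∧ (r₀ + β * r₁) * e₀ < 1} := by
  refine (isOpen_lt continuous_const continuous_id).inter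
    ((isOpen_lt continuous_const (continuous_const.add (continuous_id.mul continuous_const))).inter
      (isOpen_lt ((continuous_const.add (continuous_id.mul continuous_const)).mul continuous_const)
        continuous_const))

/-- **Growth bookkeeping of the fixed-point-fibre regime.**  If `x₀ = Log(2πim) + 2πim + u₁`,
`x₁ = Log(2πik) + 2πik + u₂` with `k ∈ [m^β, m^β + 1]` (`β > 0`) and `u → 0`, then eventually
`|Re x₀ − log m|`, `|log‖x₁‖ − β log m|`, `|Re(r₀x₀ + r₁x₁ + c) − (r₀ + βr₁)log m|` are bounded by
`E = (|log 2π| + log 2 + 1)(1 + |r₀| + |r₁|) + ‖c‖` and `x₁ ≠ 0`. [folklore] -/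
theorem fixedFibre_powerGrowth {β : ℝ} (hβ : 0 < β) {k : ℕ → ℕ}
    (hk : ∀ m : ℕ, (m : ℝ) ^ β ≤ (k m : ℝ) ∧ (k m : ℝ) ≤ (m : ℝ) ^ β + 1)
    {x : ℕ → Fin 2 → ℂ} {u : ℕ → ℂ × ℂ} (hu : Tendsto u atTop (𝓝 0))
    (hx0 : ∀ m, x m 0 = Complex.log (2 * Real.pi * I * (m : ℂ)) + 2 * Real.pi * I * (m : ℂ) + (u m).1)
    (hx1 : ∀ m, x m 1 = Complex.log (2 * Real.pi * I * (k m : ℂ)) + 2 * Real.pi * I * (k m : ℂ) + (u m).2)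
    (r₀ r₁ : ℝ) (c : ℂ) :
    (∀ᶠ m : ℕ in atTop, |(x m 0).re - 1 * Real.log m| ≤
        (|Real.log (2 * Real.pi)| + Real.log 2 + 1) * (1 + |r₀| + |r₁|) + ‖c‖) ∧
      (∀ᶠ m : ℕ in atTop, x m 1 ≠ 0 ∧ |Real.log ‖x m 1‖ - β * Real.log m| ≤
        (|Real.log (2 * Real.pi)| + Real.log 2 + 1) * (1 + |r₀| + |r₁|) + ‖c‖) ∧
      (∀ᶠ m : ℕ in atTop, |((r₀ : ℂ) * x m 0 + (r₁ : ℂ) * x m 1 + c).re - (r₀ + β * r₁) * Real.log m| ≤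
        (|Real.log (2 * Real.pi)| + Real.log 2 + 1) * (1 + |r₀| + |r₁|) + ‖c‖) := by
  set E : ℝ := (|Real.log (2 * Real.pi)| + Real.log 2 + 1) * (1 + |r₀| + |r₁|) + ‖c‖ with hE
  have hl2π : 0 ≤ |Real.log (2 * Real.pi)| := abs_nonneg _
  have hlog2 : (0 : ℝ) ≤ Real.log 2 := Real.log_nonneg one_le_two
  have hK1 : ∀ m : ℕ, 1 ≤ m → (1 : ℝ) ≤ k m := fun m hm => one_le_of_rpow_le hβ (fun m => (hk m).1) hm
  have hu1 : ∀ᶠ m in atTop, ‖(u m).1‖ ≤ 1 ∧ ‖(u m).2‖ ≤ 1 := by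
    have h := (tendsto_zero_iff_norm_tendsto_zero.1 hu).eventually (ge_mem_nhds zero_lt_one)
    filter_upwards [h] with m hm
    exact ⟨(norm_fst_le (u m)).trans hm, (norm_snd_le (u m)).trans hm⟩
  have hrex0 : ∀ m : ℕ, (x m 0).re = Real.log (2 * Real.pi * m) + (u m).1.re := fun m => by
    rw [hx0 m, re_expFixedPoint]
  have hrex1 : ∀ m : ℕ, (x m 1).re = Real.log (2 * Real.pi * (k m)) + (u m).2.re := fun m => by
    rw [hx1 m, re_expFixedPoint]
  have hlogk : ∀ m : ℕ, 1 ≤ m → |Real.log (k m) - β * Real.log m| ≤ Real.log 2 := by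
    intro m hm
    obtain ⟨h1, h2⟩ := log_sandwich hβ hk hm
    rw [abs_le]; constructor <;> linarith
  -- the logarithmic head of `x₁` is small against `2πk`
  have hsmall : ∀ᶠ m : ℕ in atTop, Real.log (2 * Real.pi * k m) + Real.pi + 1 ≤ Real.pi * k m := by
    have h1 := tendsto_const_div_label hβ (fun m => (hk m).1) (Real.log (2 * Real.pi) + Real.pi + 1)
    have h2 := tendsto_log_div_label hβ (fun m => (hk m).1)
    have h := h1.add h2
    rw [add_zero] at h
    filter_upwards [h.eventually (eventually_le_nhds Real.pi_pos), eventually_ge_atTop 1] with m hm hm1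
    have hkpos : (0 : ℝ) < k m := by linarith [hK1 m hm1]
    have : (Real.log (2 * Real.pi) + Real.pi + 1) / k m + Real.log (k m) / k m =
        (Real.log (2 * Real.pi * k m) + Real.pi + 1) / k m := by
      rw [Real.log_mul (by positivity) hkpos.ne']; field_simp; ring
    rw [this, div_le_iff₀ hkpos] at hm
    linarith
  refine ⟨?_, ?_, ?_⟩
  · filter_upwards [hu1, eventually_ge_atTop 1] with m hum hm1
    have hu1r : |(u m).1.re| ≤ 1 := (Complex.abs_re_le_norm _).trans hum.1
    rw [hrex0 m, Real.log_mul (by positivity) (by exact_mod_cast (show m ≠ 0 by omega)),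
      show Real.log (2 * Real.pi) + Real.log m + (u m).1.re - 1 * Real.log m =
        Real.log (2 * Real.pi) + (u m).1.re by ring]
    calc |Real.log (2 * Real.pi) + (u m).1.re| ≤ |Real.log (2 * Real.pi)| + |(u m).1.re| := abs_add_le _ _
      _ ≤ E := by rw [hE]; nlinarith [norm_nonneg c, abs_nonneg r₀, abs_nonneg r₁]
  · filter_upwards [hsmall, hu1, eventually_ge_atTop 1] with m hsm hum hm1
    have hkpos : (0 : ℝ) < k m := by linarith [hK1 m hm1]
    have hk1 : 1 ≤ k m := by exact_mod_cast (hK1 m hm1)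
    have hkC : (2 * Real.pi * I * (k m : ℂ)) ≠ 0 :=
      mul_ne_zero Complex.two_pi_I_ne_zero (by exact_mod_cast hkpos.ne')
    have hn2 : ‖2 * Real.pi * I * (k m : ℂ)‖ = 2 * Real.pi * k m := norm_two_pi_I_mul_natCast (k m)
    have hΛle : ‖Complex.log (2 * Real.pi * I * (k m : ℂ))‖ ≤ Real.log (2 * Real.pi * k m) + Real.pi :=
      norm_log_two_pi_I_mul_natCast_le hk1
    have hμk : (2 * Real.pi * I * (k m : ℂ)) * (2 * Real.pi * I * (k m : ℂ))⁻¹ = 1 := mul_inv_cancel₀ hkC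
    set g : ℂ := (2 * Real.pi * I * (k m : ℂ))⁻¹ * (Complex.log (2 * Real.pi * I * (k m : ℂ)) + (u m).2)
      with hgdef
    have hx1g : x m 1 = 2 * Real.pi * I * (k m : ℂ) * (1 + g) := by
      rw [hx1 m, hgdef]
      linear_combination (-(Complex.log (2 * Real.pi * I * (k m : ℂ)) + (u m).2)) * hμk
    have hgle : ‖g‖ ≤ 1 / 2 := by
      rw [hgdef, norm_mul, norm_inv, hn2]
      have hnum : ‖Complex.log (2 * Real.pi * I * (k m : ℂ)) + (u m).2‖ ≤ Real.pi * k m :=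
        (norm_add_le _ _).trans (by linarith [hum.2])
      rw [inv_mul_le_iff₀ (by positivity)]
      linarith
    have hg1 : 1 / 2 ≤ ‖1 + g‖ := by
      have := norm_sub_norm_le (1 : ℂ) (-g)
      rw [norm_one, norm_neg, sub_neg_eq_add] at this
      linarith
    have hg2 : ‖1 + g‖ ≤ 2 := by
      have := norm_add_le (1 : ℂ) g
      rw [norm_one] at this
      linarith
    have hnx : ‖x m 1‖ = 2 * Real.pi * k m * ‖1 + g‖ := by rw [hx1g, norm_mul, hn2]
    have hpos : 0 < ‖x m 1‖ := by rw [hnx]; positivity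
    refine ⟨norm_pos_iff.1 hpos, ?_⟩
    rw [hnx, Real.log_mul (by positivity) (by linarith), Real.log_mul (by positivity) hkpos.ne']
    have hl1 : |Real.log ‖1 + g‖| ≤ 1 := by
      rw [abs_le]
      constructor
      · have := Real.log_le_log (by norm_num) hg1
        have h12 : Real.log (1 / 2) = -Real.log 2 := by rw [one_div, Real.log_inv]
        linarith [Real.log_two_lt_d9]
      · have := Real.log_le_log (by linarith) hg2
        linarith [Real.log_two_lt_d9]
    rw [show Real.log (2 * Real.pi) + Real.log (k m) + Real.log ‖1 + g‖ - β * Real.log m =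
      Real.log (2 * Real.pi) + (Real.log (k m) - β * Real.log m) + Real.log ‖1 + g‖ by ring]
    calc _ ≤ |Real.log (2 * Real.pi) + (Real.log (k m) - β * Real.log m)| + |Real.log ‖1 + g‖| :=
          abs_add_le _ _
      _ ≤ |Real.log (2 * Real.pi)| + |Real.log (k m) - β * Real.log m| + |Real.log ‖1 + g‖| := by
          gcongr; exact abs_add_le _ _
      _ ≤ |Real.log (2 * Real.pi)| + Real.log 2 + 1 := by linarith [hlogk m hm1]
      _ ≤ E := by rw [hE]; nlinarith [norm_nonneg c, abs_nonneg r₀, abs_nonneg r₁]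
  · filter_upwards [hu1, eventually_ge_atTop 1] with m hum hm1
    have hkpos : (0 : ℝ) < k m := by linarith [hK1 m hm1]
    have hu1r : |(u m).1.re| ≤ 1 := (Complex.abs_re_le_norm _).trans hum.1
    have hu2r : |(u m).2.re| ≤ 1 := (Complex.abs_re_le_norm _).trans hum.2
    have hc : |c.re| ≤ ‖c‖ := Complex.abs_re_le_norm c
    have hlk := hlogk m hm1
    rw [Complex.add_re, Complex.add_re, Complex.re_ofReal_mul, Complex.re_ofReal_mul, hrex0 m, hrex1 m,
      Real.log_mul (by positivity) (by exact_mod_cast (show m ≠ 0 by omega)),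
      Real.log_mul (by positivity) hkpos.ne',
      show r₀ * (Real.log (2 * Real.pi) + Real.log m + (u m).1.re) +
          r₁ * (Real.log (2 * Real.pi) + Real.log (k m) + (u m).2.re) + c.re - (r₀ + β * r₁) * Real.log m =
        r₀ * (Real.log (2 * Real.pi) + (u m).1.re) +
          r₁ * (Real.log (2 * Real.pi) + (Real.log (k m) - β * Real.log m) + (u m).2.re) + c.re by ring]
    have hA : |r₀ * (Real.log (2 * Real.pi) + (u m).1.re)| ≤ |r₀| * (|Real.log (2 * Real.pi)| + 1) := by
      rw [abs_mul]
      exact mul_le_mul_of_nonneg_left ((abs_add_le _ _).trans (by linarith)) (abs_nonneg _)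
    have hB : |r₁ * (Real.log (2 * Real.pi) + (Real.log (k m) - β * Real.log m) + (u m).2.re)| ≤
        |r₁| * (|Real.log (2 * Real.pi)| + Real.log 2 + 1) := by
      rw [abs_mul]
      refine mul_le_mul_of_nonneg_left ?_ (abs_nonneg _)
      calc _ ≤ |Real.log (2 * Real.pi) + (Real.log (k m) - β * Real.log m)| + |(u m).2.re| := abs_add_le _ _
        _ ≤ |Real.log (2 * Real.pi)| + |Real.log (k m) - β * Real.log m| + |(u m).2.re| := by
            gcongr; exact abs_add_le _ _
        _ ≤ _ := by linarith
    calc _ ≤ |r₀ * (Real.log (2 * Real.pi) + (u m).1.re) +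
          r₁ * (Real.log (2 * Real.pi) + (Real.log (k m) - β * Real.log m) + (u m).2.re)| + |c.re| :=
          abs_add_le _ _
      _ ≤ |r₀ * (Real.log (2 * Real.pi) + (u m).1.re)| +
          |r₁ * (Real.log (2 * Real.pi) + (Real.log (k m) - β * Real.log m) + (u m).2.re)| + |c.re| := by
          gcongr; exact abs_add_le _ _
      _ ≤ E := by
          rw [hE]
          nlinarith [abs_nonneg r₀, abs_nonneg r₁]

/-- **THEOREM (Zariski density with a zero second fibre polynomial).**  `F₁ = 0`, `r₀ ∉ ℚ ∨ r₁ ∉ ℚ`,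
and SOME `β > 0` with `0 < r₀ + βr₁` and `(r₀ + βr₁)(deg F₀ + 1) < 1` ⟹ `I(W ∩ Γ_exp) = I(W)` for
`W = {x₂ = r₀x₀ + r₁x₁ + c, y₀ = x₀ + y₂F₀(y₂), y₁ = x₁}`. (new)
[cite: MantovaMasser2023, §1 p.5 (the open case dim π(V) = 2 in ℂ³×ℂˣ³)] -/
theorem unprojectedDense_polyFibredGraph_fixedFibre (F : Fin 2 → Polynomial ℂ) (hF1 : F 1 = 0)
    (r₀ r₁ : ℝ) (hirr : Irrational r₀ ∨ Irrational r₁) (c : ℂ)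
    (hadm : ∃ β : ℝ, 0 < β ∧ 0 < r₀ + β * r₁ ∧ (r₀ + β * r₁) * (((F 0).natDegree + 1 : ℕ) : ℝ) < 1) :
    UnprojectedDense (polyFibredGraph (hyperplanePoly ![r₀, r₁] c) (fun j => X j)
      (fun j => (F j).toMvPolynomial 0)) := by
  classical
  set e₀ : ℕ := (F 0).natDegree + 1 with he₀def
  have hdeg0 : (F 0).natDegree < e₀ := by omega
  set A₀ : ℕ → ℂ := fun i => (F 0).coeff i with hA₀
  set r : Fin 2 → ℝ := ![r₀, r₁] with hrdef
  obtain ⟨β₀, hβ₀⟩ := hadm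
  have hU : {β : ℝ | 0 < β ∧ 0 < r₀ + β * r₁ ∧ (r₀ + β * r₁) * (e₀ : ℝ) < 1} ∈ 𝓝 β₀ :=
    (isOpen_fixedFibreAdmissible r₀ r₁ e₀).mem_nhds hβ₀
  refine unprojectedDense_of_powerGrowth_family (isIrreducibleClosed_polyFibredGraph _ _ _)
    (by rw [zariskiDim_polyFibredGraph]) ![Sum.inr 0, Sum.inl 1, Sum.inr 2] fun H hH => ?_
  obtain ⟨β, ⟨hβ, hlo, hhi⟩, hinj⟩ := exists_mem_injOn_affine H.support
    (fun d : Fin 3 →₀ ℕ => (d 0 : ℝ) + r₀ * (d 2 : ℝ)) (fun d : Fin 3 →₀ ℕ => (d 1 : ℝ) + r₁ * (d 2 : ℝ))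
    (fun d _ d' _ h1 h2 => fixedFibreWeights_injective hirr d d' h1 h2) hU
  set γ : Fin 3 → ℝ := ![1, β, r₀ + β * r₁] with hγdef
  have hw : (fun d : Fin 3 →₀ ℕ => ∑ i, (d i : ℝ) * γ i) =
      fun d => ((d 0 : ℝ) + r₀ * (d 2 : ℝ)) + β * ((d 1 : ℝ) + r₁ * (d 2 : ℝ)) := by
    funext d
    rw [Fin.sum_univ_three]
    simp only [hγdef, Matrix.cons_val_zero, Matrix.cons_val_one, Matrix.cons_val_two,
      Matrix.tail_cons, Matrix.head_cons]
    ring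
  refine ⟨γ, by rw [hw]; exact hinj, ?_⟩
  obtain ⟨k, x, u, hk, hu, hx0, hx1, hsol⟩ := exists_solutions_fixedFibre e₀ A₀ r₀ r₁ c hβ hlo hhi
  obtain ⟨hG0, hG1, hG2⟩ := fixedFibre_powerGrowth hβ hk hu hx0 hx1 r₀ r₁ c
  set E : ℝ := (|Real.log (2 * Real.pi)| + Real.log 2 + 1) * (1 + |r₀| + |r₁|) + ‖c‖ with hE
  set P3 : ℕ → Fin 3 ⊕ Fin 3 → ℂ := fun m =>
    pgParam (hyperplanePoly r c) (fun j => X j) (fun j => (F j).toMvPolynomial 0)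
      (x m) (exp (∑ i, (r i : ℂ) * x m i + c)) with hP3
  have hℓ : ∀ m, ∑ i, (r i : ℂ) * x m i + c = (r₀ : ℂ) * x m 0 + (r₁ : ℂ) * x m 1 + c := by
    intro m; rw [Fin.sum_univ_two]; simp only [hrdef, Matrix.cons_val_zero, Matrix.cons_val_one]
  have hsolW : ∀ᶠ m in atTop, ∀ j : Fin 2, exp (x m j) = eval (x m) (X j) +
      exp (∑ i, (r i : ℂ) * x m i + c) * (F j).eval (exp (∑ i, (r i : ℂ) * x m i + c)) := by
    filter_upwards [hsol] with m hm
    rw [Fin.forall_fin_two]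
    refine ⟨?_, ?_⟩
    · rw [eval_X, Polynomial.eval_eq_sum_range' hdeg0]; exact hm.1
    · rw [eval_X, hF1, Polynomial.eval_zero, mul_zero, add_zero]; exact hm.2
  refine ⟨P3, fun m => Real.log m, E, Real.tendsto_log_atTop.comp tendsto_natCast_atTop_atTop, ?_,
    fun i => ?_⟩
  · filter_upwards [hsolW] with m hm
    exact ⟨pgParam_mem _ _ _ _ _, pgParam_hyperplane_mem_expGraph r c (fun j => X j) F hm⟩
  fin_cases i
  · simp only [hγdef, Fin.zero_eta, Matrix.cons_val_zero]
    filter_upwards [hsolW, hG0] with m hm hg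
    have hcoord : P3 m (Sum.inr 0) = exp (x m 0) := by
      have e0 : (Sum.inr 0 : Fin 3 ⊕ Fin 3) = Sum.inr (Fin.castSucc (0 : Fin 2)) := rfl
      simp only [hP3, e0, pgParam_inr, pMulParam_castSucc]
      rw [hm 0, MvPolynomial.eval_toMvPolynomial, Fin.cons_zero]
    refine ⟨by rw [hcoord]; exact Complex.exp_ne_zero _, ?_⟩
    rw [hcoord, Complex.norm_exp, Real.log_exp]
    exact hg
  · simp only [hγdef, Fin.mk_one, Matrix.cons_val_one, Matrix.cons_val_zero]
    filter_upwards [hG1] with m hg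
    have hcoord : P3 m (Sum.inl 1) = x m 1 := by
      have e1 : (Sum.inl 1 : Fin 3 ⊕ Fin 3) = Sum.inl (Fin.castSucc (1 : Fin 2)) := rfl
      simp only [hP3, e1, pgParam_inl_castSucc]
    rw [hcoord]
    exact hg
  · simp only [hγdef, Fin.reduceFinMk, Matrix.cons_val_two, Matrix.tail_cons, Matrix.head_cons]
    filter_upwards [hG2] with m hg
    have hcoord : P3 m (Sum.inr 2) = exp (∑ i, (r i : ℂ) * x m i + c) := by
      have e2 : (Sum.inr 2 : Fin 3 ⊕ Fin 3) = Sum.inr (Fin.last 2) := rfl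
      simp only [hP3, e2, pgParam_inr, pMulParam_last]
    refine ⟨by rw [hcoord]; exact Complex.exp_ne_zero _, ?_⟩
    rw [hcoord, Complex.norm_exp, Real.log_exp, hℓ m]
    exact hg

/-- **THEOREM (Zariski density with both fibre polynomials zero).**  `F₀ = F₁ = 0`,
`r₀ ∉ ℚ ∨ r₁ ∉ ℚ`, any `c` ⟹ `I(W ∩ Γ_exp) = I(W)` for `W = {x₂ = r₀x₀ + r₁x₁ + c, y₀ = x₀, y₁ = x₁}`:
both coordinates run over the fixed points of `exp`. (new)
[cite: MantovaMasser2023, §1 p.5 (the open case dim π(V) = 2 in ℂ³×ℂˣ³)] -/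
theorem unprojectedDense_polyFibredGraph_zeroFibres (F : Fin 2 → Polynomial ℂ) (hF0 : F 0 = 0)
    (hF1 : F 1 = 0) (r₀ r₁ : ℝ) (hirr : Irrational r₀ ∨ Irrational r₁) (c : ℂ) :
    UnprojectedDense (polyFibredGraph (hyperplanePoly ![r₀, r₁] c) (fun j => X j)
      (fun j => (F j).toMvPolynomial 0)) := by
  classical
  set r : Fin 2 → ℝ := ![r₀, r₁] with hrdef
  have hU : Set.Ioo (0 : ℝ) 2 ∈ 𝓝 (1 : ℝ) := Ioo_mem_nhds one_pos one_lt_two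
  refine unprojectedDense_of_powerGrowth_family (isIrreducibleClosed_polyFibredGraph _ _ _)
    (by rw [zariskiDim_polyFibredGraph]) ![Sum.inr 0, Sum.inl 1, Sum.inr 2] fun H hH => ?_
  obtain ⟨β, ⟨hβ, -⟩, hinj⟩ := exists_mem_injOn_affine H.support
    (fun d : Fin 3 →₀ ℕ => (d 0 : ℝ) + r₀ * (d 2 : ℝ)) (fun d : Fin 3 →₀ ℕ => (d 1 : ℝ) + r₁ * (d 2 : ℝ))
    (fun d _ d' _ h1 h2 => fixedFibreWeights_injective hirr d d' h1 h2) hU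
  set γ : Fin 3 → ℝ := ![1, β, r₀ + β * r₁] with hγdef
  have hw : (fun d : Fin 3 →₀ ℕ => ∑ i, (d i : ℝ) * γ i) =
      fun d => ((d 0 : ℝ) + r₀ * (d 2 : ℝ)) + β * ((d 1 : ℝ) + r₁ * (d 2 : ℝ)) := by
    funext d
    rw [Fin.sum_univ_three]
    simp only [hγdef, Matrix.cons_val_zero, Matrix.cons_val_one, Matrix.cons_val_two,
      Matrix.tail_cons, Matrix.head_cons]
    ring
  refine ⟨γ, by rw [hw]; exact hinj, ?_⟩
  -- the points: both coordinates fixed points of `exp`, labels `m` and `k = ⌈m^β⌉`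
  obtain ⟨v, hv, hvfix⟩ := exists_expFixedPoints
  set k : ℕ → ℕ := fun m => ⌈(m : ℝ) ^ β⌉₊ with hkdef
  have hk : ∀ m : ℕ, (m : ℝ) ^ β ≤ (k m : ℝ) ∧ (k m : ℝ) ≤ (m : ℝ) ^ β + 1 := fun m =>
    ⟨Nat.le_ceil _, (Nat.ceil_lt_add_one (by positivity)).le⟩
  have hktop : Tendsto k atTop atTop := (tendsto_natCast_atTop_iff (R := ℝ)).1
    (tendsto_atTop_mono (fun m => (hk m).1) ((tendsto_rpow_atTop hβ).comp tendsto_natCast_atTop_atTop))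
  set x : ℕ → Fin 2 → ℂ := fun m =>
    ![Complex.log (2 * Real.pi * I * (m : ℂ)) + 2 * Real.pi * I * (m : ℂ) + v m,
      Complex.log (2 * Real.pi * I * (k m : ℂ)) + 2 * Real.pi * I * (k m : ℂ) + v (k m)] with hx
  have hx0 : ∀ m, x m 0 = Complex.log (2 * Real.pi * I * (m : ℂ)) + 2 * Real.pi * I * (m : ℂ) +
      ((fun m => (v m, v (k m))) m).1 := fun m => by simp only [hx, Matrix.cons_val_zero]
  have hx1 : ∀ m, x m 1 = Complex.log (2 * Real.pi * I * (k m : ℂ)) + 2 * Real.pi * I * (k m : ℂ) +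
      ((fun m => (v m, v (k m))) m).2 := fun m => by
    simp only [hx, Matrix.cons_val_one, Matrix.cons_val_zero]
  have hu : Tendsto (fun m => (v m, v (k m))) atTop (𝓝 0) := by
    have := hv.prodMk_nhds (hv.comp hktop)
    rwa [show (((0 : ℂ), (0 : ℂ)) : ℂ × ℂ) = 0 from rfl] at this
  obtain ⟨hG0, hG1, hG2⟩ := fixedFibre_powerGrowth hβ hk hu hx0 hx1 r₀ r₁ c
  set E : ℝ := (|Real.log (2 * Real.pi)| + Real.log 2 + 1) * (1 + |r₀| + |r₁|) + ‖c‖ with hE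
  set P3 : ℕ → Fin 3 ⊕ Fin 3 → ℂ := fun m =>
    pgParam (hyperplanePoly r c) (fun j => X j) (fun j => (F j).toMvPolynomial 0)
      (x m) (exp (∑ i, (r i : ℂ) * x m i + c)) with hP3
  have hℓ : ∀ m, ∑ i, (r i : ℂ) * x m i + c = (r₀ : ℂ) * x m 0 + (r₁ : ℂ) * x m 1 + c := by
    intro m; rw [Fin.sum_univ_two]; simp only [hrdef, Matrix.cons_val_zero, Matrix.cons_val_one]
  have hsolW : ∀ᶠ m in atTop, ∀ j : Fin 2, exp (x m j) = eval (x m) (X j) +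
      exp (∑ i, (r i : ℂ) * x m i + c) * (F j).eval (exp (∑ i, (r i : ℂ) * x m i + c)) := by
    filter_upwards [hvfix, hktop.eventually hvfix] with m hm hmk
    rw [Fin.forall_fin_two]
    refine ⟨?_, ?_⟩
    · rw [eval_X, hF0, Polynomial.eval_zero, mul_zero, add_zero]
      simp only [hx, Matrix.cons_val_zero]
      exact hm
    · rw [eval_X, hF1, Polynomial.eval_zero, mul_zero, add_zero]
      simp only [hx, Matrix.cons_val_one, Matrix.cons_val_zero]
      exact hmk
  refine ⟨P3, fun m => Real.log m, E, Real.tendsto_log_atTop.comp tendsto_natCast_atTop_atTop, ?_,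
    fun i => ?_⟩
  · filter_upwards [hsolW] with m hm
    exact ⟨pgParam_mem _ _ _ _ _, pgParam_hyperplane_mem_expGraph r c (fun j => X j) F hm⟩
  fin_cases i
  · simp only [hγdef, Fin.zero_eta, Matrix.cons_val_zero]
    filter_upwards [hsolW, hG0] with m hm hg
    have hcoord : P3 m (Sum.inr 0) = exp (x m 0) := by
      have e0 : (Sum.inr 0 : Fin 3 ⊕ Fin 3) = Sum.inr (Fin.castSucc (0 : Fin 2)) := rfl
      simp only [hP3, e0, pgParam_inr, pMulParam_castSucc]
      rw [hm 0, MvPolynomial.eval_toMvPolynomial, Fin.cons_zero]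
    refine ⟨by rw [hcoord]; exact Complex.exp_ne_zero _, ?_⟩
    rw [hcoord, Complex.norm_exp, Real.log_exp]
    exact hg
  · simp only [hγdef, Fin.mk_one, Matrix.cons_val_one, Matrix.cons_val_zero]
    filter_upwards [hG1] with m hg
    have hcoord : P3 m (Sum.inl 1) = x m 1 := by
      have e1 : (Sum.inl 1 : Fin 3 ⊕ Fin 3) = Sum.inl (Fin.castSucc (1 : Fin 2)) := rfl
      simp only [hP3, e1, pgParam_inl_castSucc]
    rw [hcoord]
    exact hg
  · simp only [hγdef, Fin.reduceFinMk, Matrix.cons_val_two, Matrix.tail_cons, Matrix.head_cons]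
    filter_upwards [hG2] with m hg
    have hcoord : P3 m (Sum.inr 2) = exp (∑ i, (r i : ℂ) * x m i + c) := by
      have e2 : (Sum.inr 2 : Fin 3 ⊕ Fin 3) = Sum.inr (Fin.last 2) := rfl
      simp only [hP3, e2, pgParam_inr, pMulParam_last]
    refine ⟨by rw [hcoord]; exact Complex.exp_ne_zero _, ?_⟩
    rw [hcoord, Complex.norm_exp, Real.log_exp, hℓ m]
    exact hg

end FixedFibreDensity

end Summit.Schanuel.Schanuel.Theorems
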